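import Summits.QuantumFields.YangMills.Theorems.BalabanUVNodesN07FlatHessianCurlCurlAdapter
import Summits.QuantumFields.YangMills.Theorems.BalabanUVNodesK0Stub1FlatChartQlinLetters
import Summits.QuantumFields.YangMills.Theorems.BalabanUVNodesK0Stub1PairingsAtExtensions
import Summits.QuantumFields.YangMills.Theorems.BalabanUVNodesN07ChartLogReality
import HarnessLib

/-!
# K0⁷ STUB 1 (V20-G stub 1-G `stub_prop8StepCoPG13`), sub-target S4a — **THE A₁ LINE's `h128` BINDER FROM THE ♭ (127) SOCKET, `T = 0`**: k0-s1-w2's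
# `⟪δX, Δ_1X₁⟫ + Re φ(δ) = 0` on Hermitian-traceless `δ ∈ ker Qlin♭` ⟹ p612312∕p604735∕p608822's `∀ δ′ : bonds → 𝔰𝔲(N), QV ⇑δ′ = 0 → Σ_j Re tr((δ′ j)ᴴ((DV ⇑X₁) j + W j)) = 0`,
# with the test classes identified (`QV δ = 0 ↔ Qlin♭ δ = 0`), the Hessian letter moved from S1's `Δ_1` to `Δ_a` (n07-w1 p624107 + g5 hDK under the slice), and the
# current's pairing identity DISCHARGED for the rescaled, traceless-projected Sect. F current `(i·c²·η^d·η⁻¹)•W♮_S`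

Cell `pub-ymgap`, width seat `pub-ymgap-k0-s1-w1` g8 (CLAIM-4; HANDOFF § g5∕g6 (t1) «ONE `exact`-junction file feeding p604735∕p608822∕p612312's `h128` with T = 0»; k0-s1-w2 g6
«say if you want the `K_V`-currency corollary … or take it in your lane» — taken).  `--kind proof --supports stmt-QuantumFields-20541 --as helper`; count-neutral.
[15] = [Balaban1985Variational]; [B6] = [Balaban1984PropagatorsII]; [5] = [Balaban1985BackgroundPropagators]; [B7AVG] = [Balaban1985Averaging].

WHY.  On the ♭ road the (127) socket lands in S1's currency (k0-s1-w2 ✓`K0Stub1Eq157FlatScaledS1.inner_hessOpAt_add_re_eq_zero_of_stationary` ∘ p640294 ∘ D‴: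
`socket127_flat_of_letters`): for every Hermitian-traceless `δ` with `Qlin♭ δ = 0` and its tangent letter `⇑δX = iη•δ`, `⟪δX, hessOpAt η 1 X₁⟫_ℝ + Re φ(δ) = 0`, `φ = BE (W_S A′₁)`
the derivative of the (157) functional.  The A₁ LINE (✓`K0Stub1Letters10OnA1.exists_letters10On_A1_closed_of_adm22_T4` :231, p604735, p608822) consumes criticality as
`h128 : ∀ δ′ : bonds → 𝔰𝔲(N), QV ⇑δ′ = 0 → Σ_j Re tr((δ′ j)ᴴ ((DV ⇑X) j + W ⇑X j)) = 0` — p595460's kernel-formula letters `QV` (`QE D`), `DV` (`Δ_a = deltaAE D c 1`) and a current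
`W`.  THIS FILE is the junction, `T = 0` (no corrected current on the ♭ road): (a) TEST CLASS — `Qlin♭ A t = (L^{j(t)}η)•QV A t` (k0-s1-w4 ✓`fderiv_chartLogFlat_zero_kernel`), so
`QV δ = 0 ↔ Qlin♭ δ = 0`, and `(iη)⁻¹•⇑δ′` is Hermitian-traceless (n07-w2 ✓`neg_I_smul_mem_herm0`); (b) HESSIAN — `Σ Re tr(δ′ᴴ Δ_1X₁) = (N·c²)⁻¹·Σ Re tr(δ′ᴴ K_V⇑X₁)` (n07-w1
✓`pairing_hessOpAt_one_eq`, `K_V` = curl–curl extension) and `Σ Re tr(δ′ᴴ DV⇑X₁) = Σ Re tr(δ′ᴴ K_V⇑X₁)` on `ker QV` under the slice (153) (g5 ✓`pairing_deltaAEExt_eq_pairing_curlCurlExt`);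
(c) CURRENT — ONE displayed identity `hW : Σ_b Re tr((δ′ b)ᴴ W b) = (N·c²)·Re φ((iη)⁻¹•⇑δ′)`, DISCHARGED in §3 for `W := (i·c²·η^d·η⁻¹)•W♮_S` (`W♮_S b = W_S b − (N⁻¹tr W_S b)•1`, the
traceless projection located by k0-s1-w4 g3: Sect. F's `∇_{BE}V` has a `𝟙`-component invisible to `𝔰𝔲(N)` tests; `= (iη)•W♮_S` at the record, `c = η⁻¹ = L^k`, `d = 4`).

WHAT IS PROVED (sorry-free; no definition; axioms standard; generic `P`, `N ≥ 1` where stated).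
* §1 `fderiv_chartLogFlat_zero_eq_smul_QV` · ★ `QV_eq_zero_iff_fderiv_chartLogFlat_zero_eq_zero` · `inv_I_eta_smul_mem_herm0`.
* §2 ★★★ `h128_of_socket127_flat` — `DV`∕`QV` kernel-formula letters, `X₁ : TangentBondSU` on the slice, `φ`, `W` with `hW`, and the socket `hsock` (binders `δ δX`, herm0, `Qlin♭ δ = 0`,
  `⇑δX = iη•δ`) ⟹ **the `h128` binder VERBATIM** (`X := (b ↦ X₁ b)`).
* §3 ★★ `re_trace_pairing_rescaled_current` · `re_trace_pairing_smul_one_eq_zero` · ★★ `re_trace_pairing_rescaled_current_traceless` — `hW` for `(i·c²·η^d·η⁻¹)•W_S` and for its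
  traceless projection against `φ = BE W_S` ((27) on bonds: ✓`bondPair_PBond_eq_sum`, `τ = ntr`).
HONEST SCOPE.  Junction algebra over landed files cited BY NAME; the ♭ socket (k0-s1-w2 CLAIM-3), the rows `hWq`∕`hWA`∕`hWtr` of the A₁ line's current (k0-s1-w4 g3's adapter),
the slice (153) and the sizes are CONSUMED as hypotheses ∕ live elsewhere; NO estimate of Bałaban's proved or asserted; stub 1-G `stub_prop8StepCoPG13` ∕ K0⁷ NOT closed (ONE PEN:
not this seat); N07 NOT discharged; counts unmoved (28∕28 · 5∕27); one finite 𝕋⁴ programme at fixed ε — R4 closes the conditional finite-𝕋⁴ rung `BalabanLadder.UV` only, never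
the summit; the YM mass gap (Clay) is NOT proved by any of this; nothing continuum ∕ ℝ⁴ ∕ OS.  No `sorry`, no `def`, no `instance`, no `notation`.

References: [15] T. Bałaban, CMP **102** (1985) 277–309 ((20)–(22) p.281, (27) p.282, (44)–(45) p.285, (127)–(128) p.297, (153) p.301, (156)–(158) p.302); [B6] CMP **96**
(1984) 223–250 ((2.3) p.224, (2.19)–(2.20) p.226); [5] CMP **99** (1985) 389–434 ((3.10)–(3.11) p.392); [B7AVG] CMP **98** (1985) 17–51 ((17) p.21).
-/

set_option autoImplicit false

noncomputable section

open scoped BigOperators Matrix Matrix.Norms.L2Operator InnerProductSpace RealInnerProductSpace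

namespace Summit.QuantumFields.YangMills.Theorems.K0Stub1H128OfFlatSocket

open Literature.MathematicalPhysics.QuantumFieldTheory.Balaban1983to89
open Literature.MathematicalPhysics.QuantumFieldTheory.Balaban1983to89.Node00
open T4AdjointCovarianceUnitary (lieSU mem_lieSU_iff)
open B9AdOrthogonal (herm0)
open B9Eq39Adjoint (bondPair)
open MatrixNorms (ntr)
open B6SectADomainsV1 (Domains)
open B6SectAOperatorsV1 (BondIdx QE RE dsE dcE dcsE)
open B6SectAVectorModelV1 (deltaAE)
open Summit.QuantumFields.YangMills.Theorems.Prop8ChartDoubleBar (chartLogFlat)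
open Summit.QuantumFields.YangMills.Theorems.K0Stub1FlatChartQlinLetters (fderiv_chartLogFlat_zero_kernel)
open Summit.QuantumFields.YangMills.Theorems.K0Stub1H128OfRecordCriticality (pairing_deltaAEExt_eq_pairing_curlCurlExt)
open Summit.QuantumFields.YangMills.Theorems.K0Stub1PairingsAtExtensions (bondPair_PBond_eq_sum)
open Summit.QuantumFields.YangMills.BalabanUVNodes.N07FlatHessianCurlCurlAdapter (pairing_hessOpAt_one_eq sum_re_trace_eq_inner sum_re_trace_mul_add)
open Summit.QuantumFields.YangMills.BalabanUVNodes.N07ChartLogReality (neg_I_smul_mem_herm0)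

variable {P : Params} {N : ℕ}

/-! ## §1  The test class: `QV δ = 0 ↔ Qlin♭ δ = 0` -/

/-- **`Qlin♭` IS `QV` RESCALED INDEX BY INDEX**: for p595460's kernel-formula letter `QV` of `QE D` and the ♭ linearisation `Qlin♭ = fderiv ℂ (chartLogFlat η D) 0`:
`Qlin♭ A t = (L^{j(t)}·η)•QV A t` (k0-s1-w4 ✓`fderiv_chartLogFlat_zero_kernel`). [cite: Balaban1985Variational, (20) p.281, (44)-(45) p.285; Balaban1984PropagatorsII, (2.3) p.224] -/
theorem fderiv_chartLogFlat_zero_eq_smul_QV {instDE : DecidableEq (PBond P 0)} (η : ℝ) (D : Domains P)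
    {QV : (PBond P 0 → Matrix (Fin N) (Fin N) ℂ) →ₗ[ℂ] (BondIdx D → Matrix (Fin N) (Fin N) ℂ)}
    (hQV : ∀ (A : PBond P 0 → Matrix (Fin N) (Fin N) ℂ) (t : BondIdx D), QV A t = ∑ j, ((WithLp.ofLp (QE D (WithLp.toLp 2 (Pi.single j 1))) t : ℝ) : ℂ) • A j)
    (A : PBond P 0 → Matrix (Fin N) (Fin N) ℂ) (t : BondIdx D) :
    fderiv ℂ (chartLogFlat η D : (PBond P 0 → Matrix (Fin N) (Fin N) ℂ) → BondIdx D → Matrix (Fin N) (Fin N) ℂ) 0 A t =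
      (((P.L : ℝ) ^ (t.1.1 : ℕ) * η : ℝ) : ℂ) • QV A t := by
  obtain rfl : instDE = B6Prop26ReachTransplant.instDecidableEqPBond P 0 := Subsingleton.elim _ _
  rw [fderiv_chartLogFlat_zero_kernel, hQV, Finset.smul_sum]
  refine Finset.sum_congr rfl fun b _ => ?_
  rw [smul_smul, ← Complex.ofReal_mul]

/-- ★ **THE TEST CLASSES AGREE**: `QV δ = 0 ↔ Qlin♭ δ = 0` (`η ≠ 0`) — print's straight multi-level kernel in p595460's `QV` currency (the A₁ line's `h128` tests) IS the
♭ socket's `ker Qlin♭`. [cite: Balaban1985Variational, (20) p.281, (44)-(45) p.285, (127)-(128) p.297; Balaban1984PropagatorsII, (2.3) p.224] -/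
theorem QV_eq_zero_iff_fderiv_chartLogFlat_zero_eq_zero {instDE : DecidableEq (PBond P 0)} {η : ℝ} (hη : η ≠ 0) (D : Domains P)
    {QV : (PBond P 0 → Matrix (Fin N) (Fin N) ℂ) →ₗ[ℂ] (BondIdx D → Matrix (Fin N) (Fin N) ℂ)}
    (hQV : ∀ (A : PBond P 0 → Matrix (Fin N) (Fin N) ℂ) (t : BondIdx D), QV A t = ∑ j, ((WithLp.ofLp (QE D (WithLp.toLp 2 (Pi.single j 1))) t : ℝ) : ℂ) • A j)
    (δ : PBond P 0 → Matrix (Fin N) (Fin N) ℂ) :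
    QV δ = 0 ↔ fderiv ℂ (chartLogFlat η D : (PBond P 0 → Matrix (Fin N) (Fin N) ℂ) → BondIdx D → Matrix (Fin N) (Fin N) ℂ) 0 δ = 0 := by
  have hne : ∀ t : BondIdx D, (((P.L : ℝ) ^ (t.1.1 : ℕ) * η : ℝ) : ℂ) ≠ 0 := fun t =>
    Complex.ofReal_ne_zero.2 (mul_ne_zero (pow_ne_zero _ (Nat.cast_ne_zero.2 P.L_pos.ne')) hη)
  constructor
  · intro h
    funext t
    rw [fderiv_chartLogFlat_zero_eq_smul_QV η D hQV, h, Pi.zero_apply, smul_zero]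
  · intro h
    funext t
    have ht := congrFun h t
    rw [fderiv_chartLogFlat_zero_eq_smul_QV η D hQV, Pi.zero_apply, smul_eq_zero] at ht
    rw [Pi.zero_apply]
    exact ht.resolve_left (hne t)

/-- the Hermitian letter `(iη)⁻¹•Y` of an `𝔰𝔲(N)`-valued test is Hermitian traceless. [cite: Balaban1985Variational, (22) p.281, (156) p.302] -/
theorem inv_I_eta_smul_mem_herm0 {η : ℝ} {Y : Matrix (Fin N) (Fin N) ℂ} (hY : Y ∈ lieSU (Fin N)) : (Complex.I * (η : ℂ))⁻¹ • Y ∈ herm0 (Fin N) := by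
  have h : (Complex.I * (η : ℂ))⁻¹ = ((η⁻¹ : ℝ) : ℂ) * (-Complex.I) := by
    rw [mul_inv, Complex.inv_I, Complex.ofReal_inv]; ring
  rw [h, mul_smul, Complex.coe_smul]
  exact (herm0 (Fin N)).smul_mem _ (neg_I_smul_mem_herm0 hY)

/-! ## §2  THE JUNCTION: the ♭ socket's `⟪δX, Δ_1X₁⟫ + Re φ(δ) = 0` on `ker Qlin♭` ⟹ the A₁ line's `h128` on `ker QV` -/

section Junction

variable [NeZero N]

/-- ★★★ **THE A₁ LINE's `h128` BINDER FROM THE ♭ (127) SOCKET (`T = 0`).**  Letters: p595460's kernel-formula `DV` (`Δ_a = deltaAE D c w`), `QV` (`QE D`); the tangent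
`X₁ : TangentBondSU P 0 N` ON THE SLICE (153) (`RE D c (dsE c (Re φ′∘⇑X₁)) = 0` for every reading `φ′`); a current FIELD `W` (the A₁ line's `W ⇑X`) and the S4b functional `φ`
(D‴'s `BE (W_S A′₁)`) tied by the ONE displayed pairing identity `hW`: `Σ_b Re tr((δ′ b)ᴴ W b) = (N·c²)·Re φ((iη)⁻¹•⇑δ′)` for `𝔰𝔲(N)`-valued `δ′`; and THE SOCKET in k0-s1-w2's shape
(✓`K0Stub1Eq157FlatScaledS1` §3 ∕ CLAIM-3 `socket127_flat_of_letters`): for every Hermitian-traceless `δ` with `Qlin♭ δ = 0` and its tangent letter `δX` (`⇑δX = iη•δ`),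
`⟪δX, hessOpAt η 1 X₁⟫_ℝ + Re φ(δ) = 0`.  THEN **`∀ δ′ : bonds → 𝔰𝔲(N)`, `QV ⇑δ′ = 0 → Σ_b Re tr((δ′ b)ᴴ ((DV ⇑X₁) b + W b)) = 0`** — the `h128` binder of
✓`K0Stub1Letters10OnA1.exists_letters10On_A1_closed_of_adm22_T4` ∕ p604735 ∕ p608822 VERBATIM.  Proof: tests agree (§1); `⟪δ′, Δ_1X₁⟫ = (N·c²)⁻¹·Σ Re tr(δ′ᴴ K_V⇑X₁)`
(n07-w1 ✓`pairing_hessOpAt_one_eq`, `K_V` = curl–curl extension); `Σ Re tr(δ′ᴴ DV⇑X₁) = Σ Re tr(δ′ᴴ K_V⇑X₁)` on `ker QV` under the slice (g5 ✓`pairing_deltaAEExt_eq_pairing_curlCurlExt`,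
hDK); the current by `hW`.
[cite: Balaban1985Variational, (127)-(128) p.297, (153) p.301, (156)-(158) p.302; Balaban1984PropagatorsII, (2.19)-(2.20) p.226; Balaban1985BackgroundPropagators, (3.10)-(3.11) p.392] -/
theorem h128_of_socket127_flat {instDE : DecidableEq (PBond P 0)} (D : Domains P) {η c : ℝ} (hη : η ≠ 0) (hc : c ≠ 0) (w : BondIdx D → ℝ)
    {DV : (PBond P 0 → Matrix (Fin N) (Fin N) ℂ) →ₗ[ℂ] (PBond P 0 → Matrix (Fin N) (Fin N) ℂ)}
    {QV : (PBond P 0 → Matrix (Fin N) (Fin N) ℂ) →ₗ[ℂ] (BondIdx D → Matrix (Fin N) (Fin N) ℂ)}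
    (hDV : ∀ (A : PBond P 0 → Matrix (Fin N) (Fin N) ℂ) (b : PBond P 0),
      DV A b = ∑ j, ((WithLp.ofLp (deltaAE D c w (WithLp.toLp 2 (Pi.single j 1))) b : ℝ) : ℂ) • A j)
    (hQV : ∀ (A : PBond P 0 → Matrix (Fin N) (Fin N) ℂ) (t : BondIdx D), QV A t = ∑ j, ((WithLp.ofLp (QE D (WithLp.toLp 2 (Pi.single j 1))) t : ℝ) : ℂ) • A j)
    (X₁ : TangentBondSU P 0 N)
    (hslice : ∀ φ' : Matrix (Fin N) (Fin N) ℂ →L[ℂ] ℂ,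
      RE D c (dsE c (WithLp.toLp 2 (fun b => (φ' ((X₁ b : lieSU (Fin N)) : Matrix (Fin N) (Fin N) ℂ)).re))) = 0)
    (φ : (PBond P 0 → Matrix (Fin N) (Fin N) ℂ) →L[ℂ] ℂ) (W : PBond P 0 → Matrix (Fin N) (Fin N) ℂ)
    (hW : ∀ δ' : PBond P 0 → lieSU (Fin N),
      ∑ b, ((((δ' b : lieSU (Fin N)) : Matrix (Fin N) (Fin N) ℂ))ᴴ * W b).trace.re =
        ((N : ℝ) * c ^ 2) * (φ (fun b => (Complex.I * (η : ℂ))⁻¹ • ((δ' b : lieSU (Fin N)) : Matrix (Fin N) (Fin N) ℂ))).re)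
    (hsock : ∀ (δ : PBond P 0 → Matrix (Fin N) (Fin N) ℂ) (δX : TangentBondSU P 0 N), (∀ b, δ b ∈ herm0 (Fin N)) →
      fderiv ℂ (chartLogFlat η D : (PBond P 0 → Matrix (Fin N) (Fin N) ℂ) → BondIdx D → Matrix (Fin N) (Fin N) ℂ) 0 δ = 0 →
      (∀ b, ((δX b : lieSU (Fin N)) : Matrix (Fin N) (Fin N) ℂ) = (Complex.I * (η : ℂ)) • δ b) →
      ⟪δX, hessOpAt η (1 : GaugeField P 0 (SU N)) X₁⟫_ℝ + (φ δ).re = 0) :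
    ∀ δ' : PBond P 0 → lieSU (Fin N), QV (fun j => ((δ' j : lieSU (Fin N)) : Matrix (Fin N) (Fin N) ℂ)) = 0 →
      ∑ j, ((((δ' j : lieSU (Fin N)) : Matrix (Fin N) (Fin N) ℂ))ᴴ *
        (DV (fun b => ((X₁ b : lieSU (Fin N)) : Matrix (Fin N) (Fin N) ℂ)) j + W j)).trace.re = 0 := by
  intro δ' hQ
  have hIη : (Complex.I * (η : ℂ)) ≠ 0 := mul_ne_zero Complex.I_ne_zero (Complex.ofReal_ne_zero.2 hη)
  have hNc : (N : ℝ) * c ^ 2 ≠ 0 := mul_ne_zero (Nat.cast_ne_zero.mpr (NeZero.ne N)) (pow_ne_zero 2 hc)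
  -- the Hermitian test and its tangent letter
  set δ : PBond P 0 → Matrix (Fin N) (Fin N) ℂ := fun b => (Complex.I * (η : ℂ))⁻¹ • ((δ' b : lieSU (Fin N)) : Matrix (Fin N) (Fin N) ℂ) with hδ
  have hδh : ∀ b, δ b ∈ herm0 (Fin N) := fun b => inv_I_eta_smul_mem_herm0 (δ' b).2
  let δX : TangentBondSU P 0 N := WithLp.toLp 2 δ'
  have hδX : ∀ b, ((δX b : lieSU (Fin N)) : Matrix (Fin N) (Fin N) ℂ) = (Complex.I * (η : ℂ)) • δ b := by
    intro b
    show ((δ' b : lieSU (Fin N)) : Matrix (Fin N) (Fin N) ℂ) = (Complex.I * (η : ℂ)) • ((Complex.I * (η : ℂ))⁻¹ • ((δ' b : lieSU (Fin N)) : Matrix (Fin N) (Fin N) ℂ))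
    rw [smul_smul, mul_inv_cancel₀ hIη, one_smul]
  -- `Qlin♭ δ = 0`
  have hQlin' : fderiv ℂ (chartLogFlat η D : (PBond P 0 → Matrix (Fin N) (Fin N) ℂ) → BondIdx D → Matrix (Fin N) (Fin N) ℂ) 0
      (fun j => ((δ' j : lieSU (Fin N)) : Matrix (Fin N) (Fin N) ℂ)) = 0 :=
    (QV_eq_zero_iff_fderiv_chartLogFlat_zero_eq_zero hη D hQV _).1 hQ
  have hQlin : fderiv ℂ (chartLogFlat η D : (PBond P 0 → Matrix (Fin N) (Fin N) ℂ) → BondIdx D → Matrix (Fin N) (Fin N) ℂ) 0 δ = 0 := by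
    have e : δ = (Complex.I * (η : ℂ))⁻¹ • (fun j => ((δ' j : lieSU (Fin N)) : Matrix (Fin N) (Fin N) ℂ)) := rfl
    rw [e, map_smul, hQlin', smul_zero]
  -- the socket
  have hs := hsock δ δX hδh hQlin hδX
  -- the curl–curl extension `K_V` by its kernel formula
  let KV : (PBond P 0 → Matrix (Fin N) (Fin N) ℂ) →ₗ[ℂ] (PBond P 0 → Matrix (Fin N) (Fin N) ℂ) :=
    LinearMap.pi fun b => ∑ j, ((WithLp.ofLp ((dcsE c ∘ₗ dcE c) (WithLp.toLp 2 (Pi.single j 1))) b : ℝ) : ℂ) •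
      (LinearMap.proj j : (PBond P 0 → Matrix (Fin N) (Fin N) ℂ) →ₗ[ℂ] Matrix (Fin N) (Fin N) ℂ)
  have hKV : ∀ (A : PBond P 0 → Matrix (Fin N) (Fin N) ℂ) (b : PBond P 0),
      KV A b = ∑ j, ((WithLp.ofLp ((dcsE c ∘ₗ dcE c) (WithLp.toLp 2 (Pi.single j 1))) b : ℝ) : ℂ) • A j := by
    intro A b
    simp only [KV, LinearMap.pi_apply, LinearMap.coe_sum, Finset.sum_apply, LinearMap.smul_apply, LinearMap.coe_proj, Function.eval]
  -- Hessian term: `Σ Re tr(δ′ᴴ DV⇑X₁) = Σ Re tr(δ′ᴴ K_V⇑X₁) = (N c²)·⟪δX, Δ_1X₁⟫`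
  have hDK := pairing_deltaAEExt_eq_pairing_curlCurlExt (D := D) c w hDV hKV hQV (A' := fun b => ((X₁ b : lieSU (Fin N)) : Matrix (Fin N) (Fin N) ℂ))
    hslice hQ
  have hH : ∑ b, ((((δ' b : lieSU (Fin N)) : Matrix (Fin N) (Fin N) ℂ))ᴴ * KV (fun b => ((X₁ b : lieSU (Fin N)) : Matrix (Fin N) (Fin N) ℂ)) b).trace.re =
      ((N : ℝ) * c ^ 2) * ⟪δX, hessOpAt η (1 : GaugeField P 0 (SU N)) X₁⟫_ℝ := by
    rw [← sum_re_trace_eq_inner, pairing_hessOpAt_one_eq hη hc hKV δX X₁, ← mul_assoc, mul_inv_cancel₀ hNc, one_mul]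
  rw [sum_re_trace_mul_add, hDK, hH, hW δ', ← mul_add, hs, mul_zero]

end Junction

/-! ## §3  The displayed pairing identity for the RESCALED S4b current `W := (i·c²·η^d·η⁻¹)•W_S` against `φ = BE (W_S)` ((27), `τ = N⁻¹tr`) -/

/-- ★★ **`hW` DISCHARGED FOR THE EXPLICIT CURRENT**: with `BE Y δ = η^d·Σ_b τ(Y b·δ b)` on `PBond P 0` ((27) read on bonds, `τ = N⁻¹tr`) and `𝔰𝔲(N)`-valued `δ′`:
`Σ_b Re tr((δ′ b)ᴴ ((i·c²·η^d·η⁻¹)•W_S b)) = (N·c²)·Re BE W_S ((iη)⁻¹•⇑δ′)` — so the A₁ line's current at `⇑X₁ = iη•A′₁` is `(i·c²·η^{d−1})•W_S(A′₁)` (`= iη•W_S` at `c = η⁻¹`,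
`d = 4`). [cite: Balaban1985Variational, (27) p.282, (127)-(128) p.297, (158) p.302] -/
theorem re_trace_pairing_rescaled_current [NeZero N] (η c : ℝ) (hη : η ≠ 0) (τ : Matrix (Fin N) (Fin N) ℂ →L[ℂ] ℂ) (hntr : ∀ X, τ X = ntr X)
    (BE : (PBond P 0 → Matrix (Fin N) (Fin N) ℂ) →L[ℂ] (PBond P 0 → Matrix (Fin N) (Fin N) ℂ) →L[ℂ] ℂ)
    (hBE : ∀ Y δ : PBond P 0 → Matrix (Fin N) (Fin N) ℂ, BE Y δ =
      bondPair η P.d (τ : Matrix (Fin N) (Fin N) ℂ →ₗ[ℂ] ℂ) (fun μ x => Y ⟨x, μ⟩) (fun μ x => δ ⟨x, μ⟩))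
    (WS : PBond P 0 → Matrix (Fin N) (Fin N) ℂ) (δ' : PBond P 0 → lieSU (Fin N)) :
    ∑ b, ((((δ' b : lieSU (Fin N)) : Matrix (Fin N) (Fin N) ℂ))ᴴ * ((Complex.I * (c : ℂ) ^ 2 * (η : ℂ) ^ P.d * ((η : ℂ))⁻¹) • WS b)).trace.re =
      ((N : ℝ) * c ^ 2) * (BE WS (fun b => (Complex.I * (η : ℂ))⁻¹ • ((δ' b : lieSU (Fin N)) : Matrix (Fin N) (Fin N) ℂ))).re := by
  have hη' : (η : ℂ) ≠ 0 := Complex.ofReal_ne_zero.2 hη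
  have hN0 : (N : ℂ) ≠ 0 := Nat.cast_ne_zero.2 (NeZero.ne N)
  have hIinv : (Complex.I * (η : ℂ))⁻¹ = -Complex.I * ((η : ℂ))⁻¹ := by rw [mul_inv, Complex.inv_I, neg_mul]
  have hskew : ∀ b, (((δ' b : lieSU (Fin N)) : Matrix (Fin N) (Fin N) ℂ))ᴴ = -((δ' b : lieSU (Fin N)) : Matrix (Fin N) (Fin N) ℂ) := fun b => by
    rw [← Matrix.star_eq_conjTranspose]; exact (mem_lieSU_iff.1 (δ' b).2).1
  set κ : ℂ := Complex.I * (c : ℂ) ^ 2 * (η : ℂ) ^ P.d * ((η : ℂ))⁻¹ with hκ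
  set δ₀ : PBond P 0 → Matrix (Fin N) (Fin N) ℂ := fun b => (Complex.I * (η : ℂ))⁻¹ • ((δ' b : lieSU (Fin N)) : Matrix (Fin N) (Fin N) ℂ) with hδ₀
  set S : ℂ := ∑ b, (WS b * ((δ' b : lieSU (Fin N)) : Matrix (Fin N) (Fin N) ℂ)).trace with hS
  -- the left member
  have hL : ∑ b, ((((δ' b : lieSU (Fin N)) : Matrix (Fin N) (Fin N) ℂ))ᴴ * (κ • WS b)).trace.re = (-κ * S).re := by
    rw [hS, Finset.mul_sum, Complex.re_sum]
    refine Finset.sum_congr rfl fun b _ => ?_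
    rw [hskew, Matrix.mul_smul, Matrix.trace_smul, neg_mul, Matrix.trace_neg, Matrix.trace_mul_comm, smul_eq_mul, mul_neg, neg_mul]
  -- the right member
  have hτb : ∀ b, τ (WS b * δ₀ b) = (Complex.I * (η : ℂ))⁻¹ * ((N : ℂ))⁻¹ * (WS b * ((δ' b : lieSU (Fin N)) : Matrix (Fin N) (Fin N) ℂ)).trace := by
    intro b
    rw [hntr, hδ₀, Matrix.mul_smul]
    simp only [MatrixNorms.ntr]
    rw [Matrix.trace_smul, smul_eq_mul, Fintype.card_fin, div_eq_mul_inv]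
    ring
  have hR : BE WS δ₀ = (η : ℂ) ^ P.d * ((Complex.I * (η : ℂ))⁻¹ * ((N : ℂ))⁻¹ * S) := by
    rw [hBE, bondPair_PBond_eq_sum]
    congr 1
    rw [hS, Finset.mul_sum]
    exact Finset.sum_congr rfl fun b _ => by rw [ContinuousLinearMap.coe_coe]; exact hτb b
  rw [hL, hR, ← Complex.re_ofReal_mul]
  congr 1
  rw [hκ, hIinv]
  push_cast
  field_simp

/-- the identity pairs to zero against `𝔰𝔲(N)`-valued tests: `Σ_b Re tr((δ′ b)ᴴ (z_b•1)) = 0` (`tr δ′ = 0`). [cite: Balaban1985Averaging, (17) p.21] -/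
theorem re_trace_pairing_smul_one_eq_zero (z : PBond P 0 → ℂ) (δ' : PBond P 0 → lieSU (Fin N)) :
    ∑ b, ((((δ' b : lieSU (Fin N)) : Matrix (Fin N) (Fin N) ℂ))ᴴ * (z b • (1 : Matrix (Fin N) (Fin N) ℂ))).trace.re = 0 := by
  refine Finset.sum_eq_zero fun b _ => ?_
  have htr : (((δ' b : lieSU (Fin N)) : Matrix (Fin N) (Fin N) ℂ)).trace = 0 := (mem_lieSU_iff.1 (δ' b).2).2
  rw [Matrix.mul_smul, Matrix.mul_one, Matrix.trace_smul, Matrix.trace_conjTranspose, htr, star_zero, smul_zero, Complex.zero_re]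

/-- ★★ **`hW` FOR THE TRACELESS PROJECTION OF THE RESCALED CURRENT** (k0-s1-w4 g3's LOCATED-TRACE-PART: Sect. F's `W_S = ∇_{BE}V` has a `𝟙`-component, invisible to
`𝔰𝔲(N)`-valued tests; the A₁ line's `hWA`∕`hWtr` want the traceless part): with `W♮_S b := W_S b − (N⁻¹·tr W_S b)•1`,
`Σ_b Re tr((δ′ b)ᴴ ((i·c²·η^d·η⁻¹)•W♮_S b)) = (N·c²)·Re BE W_S ((iη)⁻¹•⇑δ′)` — the SAME right member as for `W_S`. [cite: Balaban1985Variational, (27) p.282, (127)-(128) p.297, (158) p.302] -/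
theorem re_trace_pairing_rescaled_current_traceless [NeZero N] (η c : ℝ) (hη : η ≠ 0) (τ : Matrix (Fin N) (Fin N) ℂ →L[ℂ] ℂ) (hntr : ∀ X, τ X = ntr X)
    (BE : (PBond P 0 → Matrix (Fin N) (Fin N) ℂ) →L[ℂ] (PBond P 0 → Matrix (Fin N) (Fin N) ℂ) →L[ℂ] ℂ)
    (hBE : ∀ Y δ : PBond P 0 → Matrix (Fin N) (Fin N) ℂ, BE Y δ =
      bondPair η P.d (τ : Matrix (Fin N) (Fin N) ℂ →ₗ[ℂ] ℂ) (fun μ x => Y ⟨x, μ⟩) (fun μ x => δ ⟨x, μ⟩))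
    (WS : PBond P 0 → Matrix (Fin N) (Fin N) ℂ) (δ' : PBond P 0 → lieSU (Fin N)) :
    ∑ b, ((((δ' b : lieSU (Fin N)) : Matrix (Fin N) (Fin N) ℂ))ᴴ *
        ((Complex.I * (c : ℂ) ^ 2 * (η : ℂ) ^ P.d * ((η : ℂ))⁻¹) • (WS b - (((N : ℂ))⁻¹ * (WS b).trace) • (1 : Matrix (Fin N) (Fin N) ℂ)))).trace.re =
      ((N : ℝ) * c ^ 2) * (BE WS (fun b => (Complex.I * (η : ℂ))⁻¹ • ((δ' b : lieSU (Fin N)) : Matrix (Fin N) (Fin N) ℂ))).re := by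
  rw [← re_trace_pairing_rescaled_current η c hη τ hntr BE hBE WS δ',
    ← add_zero (∑ b, ((((δ' b : lieSU (Fin N)) : Matrix (Fin N) (Fin N) ℂ))ᴴ * ((Complex.I * (c : ℂ) ^ 2 * (η : ℂ) ^ P.d * ((η : ℂ))⁻¹) • WS b)).trace.re),
    ← neg_zero, ← re_trace_pairing_smul_one_eq_zero (fun b => (Complex.I * (c : ℂ) ^ 2 * (η : ℂ) ^ P.d * ((η : ℂ))⁻¹) * (((N : ℂ))⁻¹ * (WS b).trace)) δ',
    ← sub_eq_add_neg, ← Finset.sum_sub_distrib]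
  refine Finset.sum_congr rfl fun b _ => ?_
  rw [smul_sub, Matrix.mul_sub, Matrix.trace_sub, Complex.sub_re, smul_smul]

end Summit.QuantumFields.YangMills.Theorems.K0Stub1H128OfFlatSocket

end
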